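import Summits.Ventures.YMGap.YM3IR.BalabanCeilings
import Summits.Ventures.YMGap.RobustBall.TorusRowsSU3StarCertifiedWCells
import HarnessLib

/-!
# YM3IR / BalabanCeilingsSU3CertifiedW — the §Y4 sentence for `SU(3)` on the TIER-2 (weighted, infinite-range) ball at engine-2's
CERTIFIED-STAR W row (Wilson `β_W = 3/4`, GIVEN the cell's one-link inputs H1/H2), with the counted crossover (theorems only; no new
conjecture name)

HONEST FRAMING (cell pub-ymgap, track Y4 / YM3-IR, seat ym3ir-theory-1, gen 10; follow-up to `YM3IR/BalabanCeilings.lean` (every-`N` tier-2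
sentences `massGap3Cofinal_suN_W_free_of_irConjecture3(Cov)`, hypothesis-free, tree ceiling `N/64`) and `YM3IR/BalabanCeilingsSU3Certified.lean`
(tier-1 certified-star row, `β_W = 33/40`), written once ds-2's weighted robust-star door `RobustBall/RobustStarDoorW.lean` and engine-2's
`RobustBall/TorusRowsSU3StarCertifiedW(Cells).lean` were in the tree).  This file claims NO summit, NO mass gap and NO part of Bałaban's
theorems.  It is kernel-checked BOOKKEEPING: `BalabanSUN.massGap3Cofinal_suN_balaban_of_irConjecture3` at `N = 3` with track Y2's input
(`ClusterDomainClustering` on the TIER-2 ball `ClusterDomain κ_b (2/125) (1/125)`, every ball parameter `κ_b ≥ log (6/5)`) DISCHARGED BY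
NAME by engine-2's cell `RobustBall.su3_clusterDomainClusteringW_dim3_certifiedStar_threeQuarters hP hV hκb` — ds-2's WEIGHTED robust
vertex-star door (Dobrushin–Shlosman window iteration with Georgii's exponential weights, NO finite-range hypothesis) run on engine-2's
CERTIFIED one-link modulus `K = 7/5`, GIVEN H1 `OneLinkPoincareSUN 3 (3/5) (4/5)` and H2 `OneLinkVarianceBound 3 (11/30) (49/20)` (the
cell's `SU(3)` one-link hypotheses: certified computations, class C-iv, DISPLAYED, not proved here) — receiving up to tree coupling `1/4` =
Wilson `β_W = 3/4` at clustering rate `log (6/5)`, versus tree `3/64` (Wilson `9/64`) for the hypothesis-free every-`N` tier-2 sentence of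
`BalabanCeilings` at `N = 3`; on the tier-1 (finite-range) side the certified-star row reaches `11/40` (Wilson `33/40`,
`BalabanCeilingsSU3Certified`) — on the weighted ball the door, not the certificate radius, binds (engine-2's header).  Lattice statements
only; no continuum limit, no Millennium claim; no axiom, no `sorry`, no `def`; `0` compute.

THE HYPOTHESIS LIST, VERBATIM (`massGap3Cofinal_su3_balaban_certifiedStarW_of_pair_of_irConjecture3`): `BalabanUV3 mk` — IN PRINT (Bałaban,
CMP 102 (1985), Thm 1 p. 257 + Thm 2 p. 272), logically IDLE in the arrow (theory-2 F2; R196); `Nonempty (Family L eps0)` — print's clauses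
at one coupling (p. 256 L15–18); `0 < C_b`, `0 < κ`; `log (6/5) ≤ κ_b` (the ball parameter); H1, H2 — CERTIFIED (two engines), displayed;
`IRConjecture3 (ballOfRobustBall 3 κ_b (2/125) (1/125) (1/4)) suFrobDist (fundamentalRep (Fin 3)) (balabanCouplings L (suGroupModel 3) eps0)
C_b κ` — the CONJECTURE of record (theory-2, `YM3IR/Statement.lean`; NOT in print).  LABEL OF RECORD (R196, verbatim): a typed INTERFACE /
dictionary, NOT a reduction — with existential `(C_b, κ)` the free-family conjecture is target-equivalent on every receiving ball in the
tree (theory-2, `YM3IR/ForestWitness.lean`, `YM3IR/ForestWitnessSUN.lean`: the forest witness enters any ball containing product Haar, the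
tier-2 balls included, `ForestWitnessSUN.forestWitness3_ball`); the covariant form `IRConjecture3Cov` (`YM3IR/CovariantFamily.lean`) is a
genuine sufficient condition, possibly strictly stronger, converse NOT known — never "the remaining gap".  CONCLUSION:
`MassGap3Cofinal (balabanCouplings L (suGroupModel 3) eps0) suFrobDist (fundamentalRep (Fin 3))`.

COUNTED CROSSOVER (PROVED arithmetic, tree units `β = β_W/3`): below the ceiling `1/4` after `K + M'` steps iff `L^{M'} ≥ 4/(3·γ₀²)`
(`su3_betaTree_div_pow_le_quarter_iff`); since `γ₀² ≤ 1` this forces `M' ≥ 1` (`su3_row_certifiedStarW_crossover_pos`) — on the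
weighted ball too the highest certified `SU(3)` receiving row does not make the fronts meet.

WHY THIS IS USEFUL (one sentence).  It records, by name and kernel-checked, the §Y4 sentence for the physical colour group on the ball in
which the conjecture of record is ACTUALLY typed to receive Bałaban's output — the weighted, infinite-range `ClusterDomain κ ε₀ ε₁` of
`YM3IR/Statement.lean`, not its finite-range sub-ball — at the highest certified strong-coupling ceiling available today (`β_W = 3/4`,
H1/H2 displayed), and what that leaves for the crossover.

References: T. Bałaban, CMP 102 (1985) 255–275, p. 256 L15–18, (5) p. 256, Thm 1 p. 257, Thm 2 p. 272 [cite: Balaban1985UV3]; CMP 98 (1985)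
17–51, (11), (15) p. 19 [cite: Balaban1985Averaging] (block locality = a property of the average (15), no numbered display).
-/

noncomputable section

open MeasureTheory
open Literature.MathematicalPhysics.QuantumLattice Literature.MathematicalPhysics.QuantumFieldTheory
open Balaban1985CMP102 Balaban1985CMP102.Setting Balaban1985CMP102.Theorems
open Literature.MathematicalPhysics.QuantumFieldTheory.Balaban1983to89 (GaugeGroup HaarData)
open Summit.QuantumFields.Balaban3D.Carriers (suGroupModel)
open Summit.QuantumFields.BalabanUV.InfraRed.StrongCouplingPoincareDoorSUN (OneLinkPoincareSUN)
open Summit.QuantumFields.BalabanUV.InfraRed.StrongCouplingVarianceDoorSUN (OneLinkVarianceBound)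

namespace Summit.Ventures.YMGap.YM3IR

open CarrierBridge

/-- **`SU(3)` lattice YM₃ mass gap on Bałaban's coupling set, receiving on the TIER-2 ball at Wilson `β_W = 3/4` GIVEN H1/H2 (PROVED
bookkeeping).**  engine-2's weighted certified-star cell `RobustBall.su3_clusterDomainClusteringW_dim3_certifiedStar_threeQuarters hP hV hκb`
BY NAME (tree ceiling `1/4`, ball `ClusterDomain κ_b (2/125) (1/125)` for every `κ_b ≥ log (6/5)`, rate `log (6/5)`).  Besides the displayed
certified inputs H1/H2, the hypothesis that is neither in print nor certified is `IRConjecture3` (label of record R196: a dictionary, not a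
reduction; `BalabanUV3 mk` is logically idle). [cite: Balaban1985UV3, Thm 1 p.257; Thm 2 p.272] -/
theorem massGap3Cofinal_su3_balaban_certifiedStarW_of_pair_of_irConjecture3 {L : ℕ} {mk : Construction L} {eps0 : ℝ → ℝ}
    (hfam : Nonempty (Family L eps0)) {κ_b C_b κ : ℝ} (hκb : Real.log (6 / 5) ≤ κ_b) (hC : 0 < C_b) (hκ : 0 < κ)
    (hUV : BalabanUV3 mk) (hP : OneLinkPoincareSUN 3 (3 / 5) (4 / 5)) (hV : OneLinkVarianceBound 3 (11 / 30) (49 / 20))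
    (hIR : IRConjecture3 (ballOfRobustBall 3 κ_b (2 / 125) (1 / 125) (1 / 4)) suFrobDist (fundamentalRep (Fin 3))
      (balabanCouplings L (suGroupModel 3) eps0) C_b κ) :
    MassGap3Cofinal (balabanCouplings L (suGroupModel 3) eps0) suFrobDist
      (fundamentalRep (Fin 3) : RobustBall.SUN 3 →* Matrix (Fin 3) (Fin 3) ℂ) :=
  massGap3Cofinal_suN_balaban_of_irConjecture3 hfam hC hκ RobustBall.log_sixFifths_pos_and_log_threeHalves_pos.1 hUV
    (RobustBall.su3_clusterDomainClusteringW_dim3_certifiedStar_threeQuarters hP hV hκb).1 hIR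

/-- **The same from the COVARIANT conjecture `IRConjecture3Cov` on the tier-2 ball (PROVED bookkeeping; the §Y4 sentence shape of
`CovariantFamily.massGap3Cofinal_su2_W_of_irConjecture3Cov`, for `SU(3)` GIVEN H1/H2).**  LABEL OF RECORD for `IRConjecture3Cov` (R196,
verbatim): «⟹ target PROVED; converse NOT KNOWN; a genuine sufficient condition, possibly strictly stronger, never "the remaining gap"».
[cite: Balaban1985Averaging, (11), (15) p.19] -/
theorem massGap3Cofinal_su3_balaban_certifiedStarW_of_pair_of_irConjecture3Cov {L : ℕ} {mk : Construction L} {eps0 : ℝ → ℝ}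
    (hfam : Nonempty (Family L eps0)) {κ_b C_b κ : ℝ} (hκb : Real.log (6 / 5) ≤ κ_b) (hC : 0 < C_b) (hκ : 0 < κ)
    (hUV : BalabanUV3 mk) (hP : OneLinkPoincareSUN 3 (3 / 5) (4 / 5)) (hV : OneLinkVarianceBound 3 (11 / 30) (49 / 20))
    (hIR : IRConjecture3Cov (ballOfRobustBall 3 κ_b (2 / 125) (1 / 125) (1 / 4)) suFrobDist (fundamentalRep (Fin 3))
      (balabanCouplings L (suGroupModel 3) eps0) C_b κ) :
    MassGap3Cofinal (balabanCouplings L (suGroupModel 3) eps0) suFrobDist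
      (fundamentalRep (Fin 3) : RobustBall.SUN 3 →* Matrix (Fin 3) (Fin 3) ℂ) :=
  massGap3Cofinal_su3_balaban_certifiedStarW_of_pair_of_irConjecture3 hfam hκb hC hκ hUV hP hV (irConjecture3_of_cov hIR)

/-- **In PRINT'S quantifier order on the tier-2 ball at `β_W = 3/4` (PROVED bookkeeping):** `∃ eps0` first (print, p. 256 L15–18), then for
every ball parameter `κ_b ≥ log (6/5)` and every `C_b`, `κ`: `Nonempty (Family L eps0) → H1 → H2 → IRConjecture3` on the cell's ball
(label of record R196: a dictionary, not a reduction) `⟹ MassGap3Cofinal`. [cite: Balaban1985UV3, p.256 L15–18; Thm 2 p.272] -/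
theorem massGap3Cofinal_su3_balaban_certifiedStarW_printedOrder_of_pair_of_irConjecture3 {L : ℕ} (mk : Construction L)
    (hUV : BalabanUV3 mk) :
    ∃ eps0 : ℝ → ℝ, (∀ g : ℝ, 0 < g → 0 < eps0 g) ∧
      (∀ S : Family L eps0, ∀ k, k ≤ S.1.K → (mk (RobustBall.SUN 3) (suGroupModel 3) S.1).ineq41_47 k) ∧
      ∀ (κ_b C_b κ : ℝ), Real.log (6 / 5) ≤ κ_b → 0 < C_b → 0 < κ → Nonempty (Family L eps0) →
        OneLinkPoincareSUN 3 (3 / 5) (4 / 5) → OneLinkVarianceBound 3 (11 / 30) (49 / 20) →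
        IRConjecture3 (ballOfRobustBall 3 κ_b (2 / 125) (1 / 125) (1 / 4)) suFrobDist (fundamentalRep (Fin 3))
          (balabanCouplings L (suGroupModel 3) eps0) C_b κ →
          MassGap3Cofinal (balabanCouplings L (suGroupModel 3) eps0) suFrobDist
            (fundamentalRep (Fin 3) : RobustBall.SUN 3 →* Matrix (Fin 3) (Fin 3) ℂ) := by
  obtain ⟨eps0, hpos, h2, h⟩ := massGap3Cofinal_suN_balaban_printedOrder_of_irConjecture3 (N := 3) mk hUV
  refine ⟨eps0, hpos, h2, fun κ_b C_b κ hκb hC hκ hfam hP hV hIR => ?_⟩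
  exact h (ballOfRobustBall 3 κ_b (2 / 125) (1 / 125) (1 / 4)) C_b κ (Real.log (6 / 5)) hC hκ
    RobustBall.log_sixFifths_pos_and_log_threeHalves_pos.1 hfam
    (RobustBall.su3_clusterDomainClusteringW_dim3_certifiedStar_threeQuarters hP hV hκb).1 hIR

/-- **`SU(3)` at the weighted certified-star ceiling `β⋆ = 1/4` (`β_W = 3/4`; PROVED arithmetic):** a member's coupling after `K + M'`
steps is below `1/4` iff `L^{M'} ≥ 4/(3·γ₀²)`. [cite: Balaban1985UV3, (5) p.256] -/
theorem su3_betaTree_div_pow_le_quarter_iff {L : ℕ} (S : Scales L) (M' : ℕ) :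
    betaTree (suGroupModel 3) S / (L : ℝ) ^ (S.K + M') ≤ 1 / 4 ↔ 4 / (3 * Dictionary.gammaSq S) ≤ (L : ℝ) ^ M' := by
  rw [suN_betaTree_div_pow_le_iff S M' (by norm_num : (0 : ℝ) < 1 / 4)]
  have hγ : 0 < Dictionary.gammaSq S := Dictionary.gammaSq_pos S
  have e : (((3 : ℕ) : ℝ) * Dictionary.gammaSq S * (1 / 4))⁻¹ = 4 / (3 * Dictionary.gammaSq S) := by
    push_cast
    field_simp
  rw [e]

/-- Hence at `β⋆ = 1/4` for `SU(3)` (PROVED arithmetic; `γ₀² ≤ 1`): in the window after `K + M'` steps forces `4/3 ≤ L^{M'}`.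
[cite: Balaban1985UV3, (5) p.256] -/
theorem su3_fourThirds_le_pow_of_betaTree_div_pow_le_quarter {L : ℕ} (S : Scales L) (M' : ℕ)
    (h : betaTree (suGroupModel 3) S / (L : ℝ) ^ (S.K + M') ≤ 1 / 4) : (4 : ℝ) / 3 ≤ (L : ℝ) ^ M' := by
  have hγ : 0 < Dictionary.gammaSq S := Dictionary.gammaSq_pos S
  have hγ1 : Dictionary.gammaSq S ≤ 1 := Dictionary.gammaSq_le_one S
  have h1 : 4 / (3 * Dictionary.gammaSq S) ≤ (L : ℝ) ^ M' := (su3_betaTree_div_pow_le_quarter_iff S M').1 h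
  have h2 : (4 : ℝ) / 3 ≤ 4 / (3 * Dictionary.gammaSq S) := by
    rw [div_le_div_iff₀ (by norm_num : (0 : ℝ) < 3) (by positivity)]
    nlinarith
  exact h2.trans h1

/-- **The conjecture's counted task on the `SU(3)` tier-2 `β_W = 3/4` row (PROVED arithmetic): still at least ONE block-RG step beyond
Bałaban's `K` at `O(1)` effective coupling (`M' ≠ 0`), for every admissible `γ₀`, at the cell's ball for the record (ball parameter
`κ_b = log (6/5)`).** [cite: Balaban1985UV3, (5) p.256] -/
theorem su3_row_certifiedStarW_crossover_pos {L : ℕ} (S : Scales L) (M' : ℕ)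
    (h : betaTree (suGroupModel 3) S / (L : ℝ) ^ (S.K + M') ≤
      (ballOfRobustBall 3 (Real.log (6 / 5)) (2 / 125) (1 / 125) (1 / 4)).βstar) :
    M' ≠ 0 := by
  have h43 : (4 : ℝ) / 3 ≤ (L : ℝ) ^ M' := su3_fourThirds_le_pow_of_betaTree_div_pow_le_quarter S M' h
  rintro rfl
  norm_num at h43

end Summit.Ventures.YMGap.YM3IR

end
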